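import Summits.ResolutionOfSingularities.ResolutionOfSingularities.Theorems.EquisingularLiftEquisingularLiftNatNDInvPersists
import Literature.AlgebraicGeometry.Resolution.Blowups
import HarnessLib

/-!
# [OURS · L1 W4.5(b) · EL♮(3)] NOSE RESIDUE STRUCTURE, brick 11 — THE CENTRE LOCK: off the centre of a blow-up (indeed of any morphism that is an
# isomorphism over the complement of a closed `Z`) regularity of the reduced strict transform is UNCHANGED; in particular the strict transform stays
# non-regular over every non-regular point of `T ∖ Z` — so a singular curve of the running surface is only ever improved by a move whose centre contains it

Cell `res-hironaka`, rung L, slot W4.5(b), D-0157 DOOR 1 width seat `res-L1-w45b-nose-w4` (census verdict word S_ν(4), STATUS 2026-08-28T17:47Z, step (1));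
crux CHILD EL♮(3) = stmt-ResolutionOfSingularities-20148. OURS; NOT a statement of any manuscript; nothing of [Hironaka2017] is asserted or used; AI kernel work,
weaker than expert review. Resolution of singularities in positive characteristic is NOT proved here. No `sorry`, no new definition, no instance, no notation;
standard axioms. `--kind proof --supports stmt-ResolutionOfSingularities-20148 --as helper`.  This file GENERALISES res-L1-w45b-lead-2's §Persist of ✓ p640760
(`…NatNDInvPersists`, the case `Z = {x}`) from a point to an arbitrary closed centre `Z`, proofs adapted line by line.

* §1 `isIso_stalkMap_of_isIso_restrict_complZ` / `existsUnique_preimage_of_isIso_restrict_complZ` / `mem_of_mem_closure_of_not_memZ` /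
  `stalkIdeal_vanishingIdeal_closure_eq_mapZ` / ★ `isRegularLocalRing_subscheme_stalk_iff_of_isIso_restrict_complZ` — for `f : F₉ ⟶ F₁` with
  `IsIso (f ∣_ Zᶜ)`, `T₉` closed and the bookkeeping `T₉ ∩ f⁻¹ Zᶜ = f⁻¹ (T₁ ∖ Z)`: at a point `y` with `f y ∉ Z`, the reduced closure of `T₉` is regular at the point over
  `y` iff the reduced closure of `T₁` is regular at the point over `f y`.
* §2 ★ `strictTransform_bookkeeping_of_isClosed` — for closed `T₁`, `T₉ := closure (f⁻¹ (T₁ ∖ Z))` satisfies the bookkeeping identity; ★ `IsBlowup.isIso_restrict_complZ` —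
  a blow-up of `𝓘(Z)` is an isomorphism over `Zᶜ` (Literature `IsBlowup.isIso_compl`); ★ `centreLock_of_isBlowup` — THE LOCK: for a blow-up `υ` of the reduced `Z`
  and closed `T₁`, at every `y` over `T₁ ∖ Z` the reduced strict transform `(closure υ⁻¹(T₁ ∖ Z))~` is regular at `y` iff `T̃₁` is regular at `υ y` — a
  non-regular point of `T̃₁` off the centre stays non-regular one floor up.
-/

set_option linter.dupNamespace false

noncomputable section

open CategoryTheory CategoryTheory.Limits AlgebraicGeometry TopologicalSpace Topology
open Literature.AlgebraicGeometry.Resolution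
open AlgebraicGeometry.Scheme.IdealSheafData

namespace Summit.ResolutionOfSingularities.ResolutionOfSingularities.Cruxes.EquisingularLiftNat.Sections

/-! ## §1 Transport off a closed centre (lead-2's §Persist with `{x}` ↦ `Z`) -/

section PersistZ

variable {F₉ F₁ : Scheme.{0}} (f : F₉ ⟶ F₁) (Z : Set F₁) (hZ : IsClosed Z)

/-- Off the centre: the stalk maps of a morphism that restricts to an isomorphism over `Zᶜ` are isomorphisms at points not over `Z`. [folklore] -/
theorem isIso_stalkMap_of_isIso_restrict_complZ [IsIso (f ∣_ (⟨Zᶜ, hZ.isOpen_compl⟩ : F₁.Opens))] (y : F₉) (hy : f y ∉ Z) :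
    IsIso (f.stalkMap y) := by
  -- adapted from Theorems/EquisingularLiftEquisingularLiftNatNDInvPersists.lean (res-L1-w45b-lead-2, point case)
  have hyU : f y ∈ (⟨Zᶜ, hZ.isOpen_compl⟩ : F₁.Opens) := hy
  have h1 : IsIso ((f ∣_ (⟨Zᶜ, hZ.isOpen_compl⟩ : F₁.Opens)).stalkMap ⟨y, hyU⟩) := inferInstance
  have h2 := (Arrow.isIso_iff_isIso_of_isIso (morphismRestrictStalkMap f (⟨Zᶜ, hZ.isOpen_compl⟩ : F₁.Opens) ⟨y, hyU⟩).hom).mp h1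
  simpa using h2

/-- Off the centre: every point of `Zᶜ` has exactly one preimage. [folklore] -/
theorem existsUnique_preimage_of_isIso_restrict_complZ [IsIso (f ∣_ (⟨Zᶜ, hZ.isOpen_compl⟩ : F₁.Opens))] (x' : F₁) (hx' : x' ∉ Z) :
    ∃! y : F₉, f y = x' := by
  set U : F₁.Opens := ⟨Zᶜ, hZ.isOpen_compl⟩ with hU
  have hbij := ConcreteCategory.bijective_of_isIso (f ∣_ U).base
  have hx'U : x' ∈ U := hx'
  obtain ⟨y', hy'⟩ := hbij.2 ⟨x', hx'U⟩
  refine ⟨y'.1, ?_, ?_⟩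
  · have := congrArg Subtype.val hy'
    simpa [morphismRestrict_base_coe] using this
  · intro y hy
    have hyU : f y ∈ U := by rw [hy]; exact hx'U
    have : (f ∣_ U).base ⟨y, hyU⟩ = (f ∣_ U).base y' := by
      rw [hy']
      apply Subtype.ext
      simpa [morphismRestrict_base_coe] using hy
    exact congrArg Subtype.val (hbij.1 this)

/-- Off the centre: a point of `closure T₁` outside `Z` lies in `T₁`, when `T₉` is closed and `T₉ ∩ f⁻¹ Zᶜ = f⁻¹ (T₁ ∖ Z)` for an `f` that is an isomorphism
over `Zᶜ`. [folklore] -/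
theorem mem_of_mem_closure_of_not_memZ [IsIso (f ∣_ (⟨Zᶜ, hZ.isOpen_compl⟩ : F₁.Opens))] (T₁ : Set F₁) (T₉ : Set F₉) (hT₉ : IsClosed T₉)
    (hbook : T₉ ∩ f ⁻¹' Zᶜ = f ⁻¹' (T₁ \ Z)) {p : F₁} (hp : p ∈ closure T₁) (hpx : p ∉ Z) : p ∈ T₁ := by
  set U : F₁.Opens := ⟨Zᶜ, hZ.isOpen_compl⟩ with hU
  by_contra hpT
  obtain ⟨y₀, hy₀, -⟩ := existsUnique_preimage_of_isIso_restrict_complZ f Z hZ p hpx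
  have hy₀T : y₀ ∉ T₉ := by
    intro h
    have : y₀ ∈ T₉ ∩ f ⁻¹' Zᶜ := ⟨h, by simpa [hy₀] using hpx⟩
    rw [hbook] at this
    exact hpT (by simpa [hy₀] using this.1)
  haveI : IsOpenImmersion ((f ⁻¹ᵁ U).ι ≫ f) := by rw [← morphismRestrict_ι]; infer_instance
  have hopen : IsOpenMap ((f ⁻¹ᵁ U).ι ≫ f).base := ((f ⁻¹ᵁ U).ι ≫ f).isOpenEmbedding.isOpenMap
  have hy₀U : y₀ ∈ f ⁻¹ᵁ U := by show f y₀ ∈ U; rw [hy₀]; exact hpx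
  let N : Set ↥(f ⁻¹ᵁ U) := (f ⁻¹ᵁ U).ι ⁻¹' T₉ᶜ
  have hN : IsOpen N := hT₉.isOpen_compl.preimage (f ⁻¹ᵁ U).ι.continuous
  have hO : IsOpen (((f ⁻¹ᵁ U).ι ≫ f).base '' N) := hopen N hN
  have hpO : p ∈ ((f ⁻¹ᵁ U).ι ≫ f).base '' N := by
    refine ⟨⟨y₀, hy₀U⟩, ?_, ?_⟩
    · show (f ⁻¹ᵁ U).ι ⟨y₀, hy₀U⟩ ∈ T₉ᶜ
      rw [Scheme.Opens.ι_apply]; exact hy₀T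
    · show ((f ⁻¹ᵁ U).ι ≫ f) ⟨y₀, hy₀U⟩ = p
      rw [Scheme.Hom.comp_apply, Scheme.Opens.ι_apply]; exact hy₀
  obtain ⟨q, hqO, hqT⟩ := mem_closure_iff.mp hp _ hO hpO
  obtain ⟨y₁, hy₁N, hy₁q⟩ := hqO
  have hfy₁ : f y₁.1 = q := by
    rw [← hy₁q, Scheme.Hom.comp_apply, Scheme.Opens.ι_apply]
  have hy₁x : f y₁.1 ∉ Z := fun h => (show f y₁.1 ∈ U from y₁.2) h
  have hmem : y₁.1 ∈ f ⁻¹' (T₁ \ Z) := by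
    show f y₁.1 ∈ T₁ \ Z
    rw [hfy₁]; exact ⟨hqT, by rw [← hfy₁]; exact hy₁x⟩
  rw [← hbook] at hmem
  exact hy₁N (show (f ⁻¹ᵁ U).ι y₁ ∈ T₉ by rw [Scheme.Opens.ι_apply]; exact hmem.1)

/-- Off the centre: the stalks of the reduced-closure ideals of `T₉` and `T₁` correspond under the stalk isomorphisms of `f`. [folklore] -/
theorem stalkIdeal_vanishingIdeal_closure_eq_mapZ [IsIso (f ∣_ (⟨Zᶜ, hZ.isOpen_compl⟩ : F₁.Opens))] (T₁ : Set F₁) (T₉ : Set F₉) (hT₉ : IsClosed T₉)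
    (hbook : T₉ ∩ f ⁻¹' Zᶜ = f ⁻¹' (T₁ \ Z)) (y : F₉) (hy : f y ∉ Z) :
    stalkIdeal (vanishingIdeal (⟨closure T₉, isClosed_closure⟩ : Closeds F₉)) y =
      (stalkIdeal (vanishingIdeal (⟨closure T₁, isClosed_closure⟩ : Closeds F₁)) (f y)).map (f.stalkMap y).hom := by
  set U : F₁.Opens := ⟨Zᶜ, hZ.isOpen_compl⟩ with hU
  haveI : IsOpenImmersion ((f ⁻¹ᵁ U).ι ≫ f) := by rw [← morphismRestrict_ι]; infer_instance
  have key : (vanishingIdeal (⟨closure T₉, isClosed_closure⟩ : Closeds F₉)).comap (f ⁻¹ᵁ U).ι =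
      ((vanishingIdeal (⟨closure T₁, isClosed_closure⟩ : Closeds F₁)).comap f).comap (f ⁻¹ᵁ U).ι := by
    rw [← Scheme.IdealSheafData.comap_comp, comap_vanishingIdeal_of_isOpenImmersion,
      comap_vanishingIdeal_of_isOpenImmersion]
    congr 1
    apply TopologicalSpace.Closeds.ext
    ext y'
    simp only [TopologicalSpace.Closeds.coe_preimage, Set.mem_preimage, TopologicalSpace.Closeds.coe_mk, hT₉.closure_eq]
    have hy'x : f ((f ⁻¹ᵁ U).ι y') ∉ Z := by
      rw [Scheme.Opens.ι_apply]; exact fun h => (show f y'.1 ∈ U from y'.2) h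
    rw [Scheme.Hom.comp_apply]
    constructor
    · intro h
      have : (f ⁻¹ᵁ U).ι y' ∈ T₉ ∩ f ⁻¹' Zᶜ := ⟨h, hy'x⟩
      rw [hbook] at this
      exact subset_closure this.1
    · intro h
      have hT : f ((f ⁻¹ᵁ U).ι y') ∈ T₁ := mem_of_mem_closure_of_not_memZ f Z hZ T₁ T₉ hT₉ hbook h hy'x
      have : (f ⁻¹ᵁ U).ι y' ∈ f ⁻¹' (T₁ \ Z) := ⟨hT, hy'x⟩
      rw [← hbook] at this
      exact this.1
  have hyU : y ∈ f ⁻¹ᵁ U := hy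
  have h := (stalkIdeal_comap_eq_iff_of_isIso_stalkMap (f ⁻¹ᵁ U).ι
    (vanishingIdeal (⟨closure T₉, isClosed_closure⟩ : Closeds F₉))
    ((vanishingIdeal (⟨closure T₁, isClosed_closure⟩ : Closeds F₁)).comap f) ⟨y, hyU⟩).mp (by rw [key])
  rw [Scheme.Opens.ι_apply] at h
  rw [h, stalkIdeal_comap_eq_map]

/-- **Off the centre, regularity of the reduced strict transform is unchanged.** For `f : F₉ ⟶ F₁` an isomorphism over `Zᶜ`, `T₉` closed with
`T₉ ∩ f⁻¹ Zᶜ = f⁻¹ (T₁ ∖ Z)`, and `y` with `f y ∉ Z`: the reduced closure of `T₉` is regular at the point over `y` iff the reduced closure of `T₁` is regular at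
the point over `f y`. (res-L1-w45b-lead-2's ✓ p640760 is the case `Z = {x}`.) [folklore] -/
theorem isRegularLocalRing_subscheme_stalk_iff_of_isIso_restrict_complZ [IsIso (f ∣_ (⟨Zᶜ, hZ.isOpen_compl⟩ : F₁.Opens))] (T₁ : Set F₁)
    (T₉ : Set F₉) (hT₉ : IsClosed T₉) (hbook : T₉ ∩ f ⁻¹' Zᶜ = f ⁻¹' (T₁ \ Z)) (y : F₉) (hy : f y ∉ Z)
    (z₉ : ↥(vanishingIdeal (⟨closure T₉, isClosed_closure⟩ : Closeds F₉)).subscheme)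
    (hz₉ : ((vanishingIdeal (⟨closure T₉, isClosed_closure⟩ : Closeds F₉)).subschemeι z₉ : F₉) = y)
    (z : ↥(vanishingIdeal (⟨closure T₁, isClosed_closure⟩ : Closeds F₁)).subscheme)
    (hz : ((vanishingIdeal (⟨closure T₁, isClosed_closure⟩ : Closeds F₁)).subschemeι z : F₁) = f y) :
    IsRegularLocalRing ((vanishingIdeal (⟨closure T₉, isClosed_closure⟩ : Closeds F₉)).subscheme.presheaf.stalk z₉) ↔
      IsRegularLocalRing ((vanishingIdeal (⟨closure T₁, isClosed_closure⟩ : Closeds F₁)).subscheme.presheaf.stalk z) := by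
  rw [isRegularLocalRing_stalk_subscheme_iff, isRegularLocalRing_stalk_subscheme_iff]
  have hz₉' : (vanishingIdeal (⟨closure T₉, isClosed_closure⟩ : Closeds F₉)).subschemeι.base z₉ = y := hz₉
  have hz' : (vanishingIdeal (⟨closure T₁, isClosed_closure⟩ : Closeds F₁)).subschemeι.base z = f y := hz
  rw [hz₉', hz']
  haveI : IsIso (f.stalkMap y) := isIso_stalkMap_of_isIso_restrict_complZ f Z hZ y hy
  let e : F₁.presheaf.stalk (f y) ≃+* F₉.presheaf.stalk y := (asIso (f.stalkMap y)).commRingCatIsoToRingEquiv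
  have he : (e : F₁.presheaf.stalk (f y) →+* F₉.presheaf.stalk y) = (f.stalkMap y).hom := rfl
  have hmap : stalkIdeal (vanishingIdeal (⟨closure T₉, isClosed_closure⟩ : Closeds F₉)) y =
      (stalkIdeal (vanishingIdeal (⟨closure T₁, isClosed_closure⟩ : Closeds F₁)) (f y)).map
        (e : F₁.presheaf.stalk (f y) →+* F₉.presheaf.stalk y) := by
    rw [he]; exact stalkIdeal_vanishingIdeal_closure_eq_mapZ f Z hZ T₁ T₉ hT₉ hbook y hy
  let q := Ideal.quotientEquiv _ _ e hmap
  exact ⟨fun h => IsRegularLocalRing.of_ringEquiv q.symm, fun h => IsRegularLocalRing.of_ringEquiv q⟩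

end PersistZ

/-! ## §2 The lock for a blow-up of a reduced closed centre -/

/-- **Strict-transform bookkeeping.** For a closed `T₁` and any `f`, `T₉ := closure (f⁻¹ (T₁ ∖ Z))` satisfies `T₉ ∩ f⁻¹ Zᶜ = f⁻¹ (T₁ ∖ Z)` (the set
`f⁻¹(T₁ ∖ Z) = f⁻¹ T₁ ∩ f⁻¹ Zᶜ` is closed in the open `f⁻¹ Zᶜ`). [folklore] -/
theorem strictTransform_bookkeeping_of_isClosed {F₉ F₁ : Scheme.{0}} (f : F₉ ⟶ F₁) (Z T₁ : Set F₁) (hT₁ : IsClosed T₁) :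
    closure (f ⁻¹' (T₁ \ Z)) ∩ f ⁻¹' Zᶜ = f ⁻¹' (T₁ \ Z) := by
  apply Set.Subset.antisymm
  · rintro y ⟨hycl, hyZ⟩
    have hcl : closure (f ⁻¹' (T₁ \ Z)) ⊆ f ⁻¹' T₁ :=
      closure_minimal (fun y hy => hy.1) (hT₁.preimage f.continuous)
    exact ⟨hcl hycl, hyZ⟩
  · intro y hy
    exact ⟨subset_closure hy, hy.2⟩

/-- **A blow-up of `𝓘(Z)` is an isomorphism over `Zᶜ`** (Literature `IsBlowup.isIso_compl`, support of `𝓘(Z)` = `Z`). [cite: StacksProject, Tag 02OS] -/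
theorem IsBlowup.isIso_restrict_complZ {F₉ F₁ : Scheme.{0}} {υ : F₉ ⟶ F₁} {Z : Set F₁} {hZ : IsClosed Z}
    (hυ : IsBlowup υ (vanishingIdeal (⟨Z, hZ⟩ : Closeds F₁))) : IsIso (υ ∣_ (⟨Zᶜ, hZ.isOpen_compl⟩ : F₁.Opens)) := by
  have hO : (⟨((vanishingIdeal (⟨Z, hZ⟩ : Closeds F₁)).support : Set F₁)ᶜ,
      (vanishingIdeal (⟨Z, hZ⟩ : Closeds F₁)).support.isClosed.isOpen_compl⟩ : F₁.Opens) = ⟨Zᶜ, hZ.isOpen_compl⟩ := by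
    apply Opens.ext
    show ((vanishingIdeal (⟨Z, hZ⟩ : Closeds F₁)).support : Set F₁)ᶜ = Zᶜ
    rw [Scheme.IdealSheafData.coe_support_vanishingIdeal]
    rfl
  rw [← hO]
  exact hυ.isIso_compl

/-- **THE CENTRE LOCK.** Let `υ : F₉ ⟶ F₁` be a blow-up of the reduced closed centre `Z` and `T₁ ⊆ F₁` closed; put `T₉ := closure (υ⁻¹ (T₁ ∖ Z))` (the chains'
strict transform). Then at every `y` with `υ y ∉ Z` the reduced closure of `T₉` is regular at the point over `y` IFF the reduced closure of `T₁` is regular at the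
point over `υ y`. In particular a non-regular point of `T̃₁` OFF the centre stays non-regular one floor up: a singular curve of the running surface is only ever
improved by a move whose centre contains (the strict transform of) it — step (1) of the S_ν(4) census verdict. [folklore] -/
theorem centreLock_of_isBlowup {F₉ F₁ : Scheme.{0}} {υ : F₉ ⟶ F₁} {Z : Set F₁} {hZ : IsClosed Z}
    (hυ : IsBlowup υ (vanishingIdeal (⟨Z, hZ⟩ : Closeds F₁))) (T₁ : Set F₁) (hT₁ : IsClosed T₁) (y : F₉) (hy : υ y ∉ Z)
    (z₉ : ↥(vanishingIdeal (⟨closure (closure (υ ⁻¹' (T₁ \ Z))), isClosed_closure⟩ : Closeds F₉)).subscheme)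
    (hz₉ : ((vanishingIdeal (⟨closure (closure (υ ⁻¹' (T₁ \ Z))), isClosed_closure⟩ : Closeds F₉)).subschemeι z₉ : F₉) = y)
    (z : ↥(vanishingIdeal (⟨closure T₁, isClosed_closure⟩ : Closeds F₁)).subscheme)
    (hz : ((vanishingIdeal (⟨closure T₁, isClosed_closure⟩ : Closeds F₁)).subschemeι z : F₁) = υ y) :
    IsRegularLocalRing ((vanishingIdeal (⟨closure (closure (υ ⁻¹' (T₁ \ Z))), isClosed_closure⟩ : Closeds F₉)).subscheme.presheaf.stalk z₉) ↔
      IsRegularLocalRing ((vanishingIdeal (⟨closure T₁, isClosed_closure⟩ : Closeds F₁)).subscheme.presheaf.stalk z) := by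
  haveI := IsBlowup.isIso_restrict_complZ hυ
  exact isRegularLocalRing_subscheme_stalk_iff_of_isIso_restrict_complZ υ Z hZ T₁ (closure (υ ⁻¹' (T₁ \ Z))) isClosed_closure
    (strictTransform_bookkeeping_of_isClosed υ Z T₁ hT₁) y hy z₉ hz₉ z hz

/-- **The lock, point form used by the census**: under the same hypotheses, if `T̃₁` is NON-regular at the point over `x ∈ T₁ ∖ Z`, then `x` has exactly one
preimage `y`, `y ∈ T₉`, and the reduced strict transform is NON-regular at every point over `y`. [folklore] -/
theorem strictTransform_not_isRegularLocalRing_of_not_mem {F₉ F₁ : Scheme.{0}} {υ : F₉ ⟶ F₁} {Z : Set F₁} {hZ : IsClosed Z}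
    (hυ : IsBlowup υ (vanishingIdeal (⟨Z, hZ⟩ : Closeds F₁))) (T₁ : Set F₁) (hT₁ : IsClosed T₁) {x : F₁} (hxT : x ∈ T₁) (hxZ : x ∉ Z)
    (z : ↥(vanishingIdeal (⟨closure T₁, isClosed_closure⟩ : Closeds F₁)).subscheme)
    (hz : ((vanishingIdeal (⟨closure T₁, isClosed_closure⟩ : Closeds F₁)).subschemeι z : F₁) = x)
    (hnreg : ¬ IsRegularLocalRing ((vanishingIdeal (⟨closure T₁, isClosed_closure⟩ : Closeds F₁)).subscheme.presheaf.stalk z)) :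
    ∃ y : F₉, υ y = x ∧ y ∈ closure (υ ⁻¹' (T₁ \ Z)) ∧
      ∀ z₉ : ↥(vanishingIdeal (⟨closure (closure (υ ⁻¹' (T₁ \ Z))), isClosed_closure⟩ : Closeds F₉)).subscheme,
        ((vanishingIdeal (⟨closure (closure (υ ⁻¹' (T₁ \ Z))), isClosed_closure⟩ : Closeds F₉)).subschemeι z₉ : F₉) = y →
        ¬ IsRegularLocalRing ((vanishingIdeal (⟨closure (closure (υ ⁻¹' (T₁ \ Z))), isClosed_closure⟩ : Closeds F₉)).subscheme.presheaf.stalk z₉) := by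
  haveI := IsBlowup.isIso_restrict_complZ hυ
  obtain ⟨y, hy, -⟩ := existsUnique_preimage_of_isIso_restrict_complZ υ Z hZ x hxZ
  have hyZ : υ y ∉ Z := by rw [hy]; exact hxZ
  refine ⟨y, hy, subset_closure (show υ y ∈ T₁ \ Z from ⟨by rw [hy]; exact hxT, hyZ⟩), fun z₉ hz₉ hreg => hnreg ?_⟩
  exact (centreLock_of_isBlowup hυ T₁ hT₁ y hyZ z₉ hz₉ z (by rw [hz, hy])).mp hreg

end Summit.ResolutionOfSingularities.ResolutionOfSingularities.Cruxes.EquisingularLiftNat.Sections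

end
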